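import Mathlib
import HarnessLib
import Literature.AlgebraicGeometry.Resolution.ExceptionalCurveDegree
import Literature.AlgebraicGeometry.Resolution.ExceptionalCurvePoints
import Literature.AlgebraicGeometry.Resolution.ExceptionalPointsFinite
import Literature.AlgebraicGeometry.Resolution.ProperBirationalGlobalSections
import Summits.ResolutionOfSingularities.ResolutionOfSingularities.Theorems.HomologicalConductorNoZenoCarriedPrincipal
import Summits.ResolutionOfSingularities.ResolutionOfSingularities.Theorems.HomologicalConductorNoZenoCycleDivisorOrder
import Summits.ResolutionOfSingularities.ResolutionOfSingularities.Theorems.HomologicalConductorNoZenoStageRational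

/-!
# Crux `NoZenoR` / `NoZeno` (stmt-ResolutionOfSingularities-19943 / -16483), line `sandwich-cluster`,
# S3 G-layer target **Gb `stubG_carriedPrincipal` — PROVED** (modulo the printed facts, as registered)

Route `ResolutionOfSingularities/HomologicalConductor`.  OURS (cell res-hironaka, crux chain W4.4, seat
res-D-pv-026 as res-L0-w44-stub-9, owner of Gb per res-L0-w44-lead-1 KERNEL-L0 §16 R6 / skeleton v18);
nothing here is a statement of the manuscript under review (Hironaka 2017); AI-written, weaker than
expert review.

`stubG_carriedPrincipal_holds` has EXACTLY the type of `Sig.stubG_carriedPrincipal` of the lead's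
skeleton file v19 (HOME L/res-L0-w44-lead-1/G-targets-v19.txt), the published-facts binder
`Sig.stub_publishedSurfaceFacts` spelled out as its registered 5-conjunction
(`CossartJannsenSaito2020General ∧ Lipman1969_1_2 ∧ Lipman1969_4_1 ∧ Lipman1969_12_1_i ∧
Lipman1969_12_1_ii`): for a singular stage `T_m` (`m ≥ m₀ + 1`) of the sandwich context, a minimal
resolution `π : X ⟶ Spec T_m`, a cycle `Z : X → ℕ` and an ideal `I` of `T_m` CARRIED by `Z` along the
integral exceptional curves (`t ∈ I ↔ t = 0 ∨ ∀ η ∈ excCurvePoints π, Z η ≤ ord_η t`), the extension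
`I · 𝒪_{X,x}` is principal at every point `x` of the closed fibre (indeed at every point).

Proof (THEOREM Q-rat §1 (F4)/(A5), res-L0-w44-idea-1; Lipman 1969 (12.1) (ii)), assembling the files
of this row and of res-L0-w44-stub-3 and -stub-4:
* the gcd cycle `Z'` of `I` on the finite set `F = excCurvePoints π` (`Z ≤ Z'`, `I` carried by `Z'`,
  each `Z' η` attained by some `t_η ∈ I ∖ 0` — `I ≠ 0` because `y^N ∈ I` for `y ∈ 𝔪_{T_m} ∖ 0`,
  `N ≥ max Z`, the structure map being local along the closed fibre);
* the Cartier divisor `D = -D_{Z'}` of the cycle ideal sheaf `∏_{η ∈ F} 𝓘_{E_η}^{Z' η}` on the regular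
  `X` (`…NoZenoCycleDivisor`), with `Γ(X, 𝒪_X(D)) = {s regular | ord_η s ≥ Z' η}`
  (`…NoZenoCycleDivisorOrder.neg_cycleDivisor_isSection_iff`);
* `(𝒪_X(D) · E_η) ≥ 0`: `D + div(t_η)` is effective and avoids `η`
  (`mem_nonvanishing_neg_cycleDivisor_of_ord_eq`), so by res-L0-w44-stub-4's calculus
  (`excCurveDegree_add`, `_principal`, `_nonneg_of_isEffective`) the degree is `≥ 0`;
* `H⁰(X, 𝒪_X) = T_m` (`ProperBirationalGlobalSections`), `H¹(X, 𝒪_X) = 0` (res-L0-w44-stub-3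
  `hasTrivialCechH1_of_isResolution_tower`, from Lipman (1.2)), fibre dimension `≤ 1`
  (res-L0-w44-stub-4), and the assembly `carriedPrincipal_of_divisor_of_pred` (Lipman (12.1) (ii)).

References: J. Lipman, Publ. Math. IHÉS 36 (1969), Thm. (12.1) (ii), Prop. (1.2) [`Lipman1969`];
res-L0-w44-idea-1, THEOREM Q-rat (OURS, 2026-08-27).
-/

noncomputable section

-- single-problem summit: the doubled namespace component `ResolutionOfSingularities` is forced
set_option linter.dupNamespace false

namespace Summit.ResolutionOfSingularities.ResolutionOfSingularities.Theorems.NoZeno.SandwichCluster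

open CategoryTheory AlgebraicGeometry TopologicalSpace IsLocalRing Order
open Literature.AlgebraicGeometry.Resolution Literature.AlgebraicGeometry.Motives
open Summit.ResolutionOfSingularities.ResolutionOfSingularities.Theorems
open Summit.ResolutionOfSingularities.ResolutionOfSingularities.Theorems.NoZeno.Birth

universe u

/-! ## §1 The structure map is local along the closed fibre -/

section ClosedFibre

variable {T : Type u} [CommRing T] [IsLocalRing T] {X : Scheme.{u}} (π : X ⟶ Spec (.of T))

/-- Along the closed fibre the structure map `T → 𝒪_{X,η}` sends `𝔪_T` to non-units: if `π η` is the
closed point and `y ∈ 𝔪_T`, the image of `y` in `𝒪_{X,η}` is not a unit (it factors through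
`T → T_{𝔪} = 𝒪_{Spec T, π η}` and the local stalk map of `π`). [folklore] -/
theorem not_isUnit_germ_appTop_of_mem_maximalIdeal {η : X} (hη : π η = closedPoint T) {y : T}
    (hy : y ∈ maximalIdeal T) :
    ¬ IsUnit ((((X.presheaf.germ ⊤ η trivial).hom.comp
      (π.appTop.hom.comp (Scheme.ΓSpecIso (.of T)).inv.hom)) : T →+* X.presheaf.stalk η) y) := by
  -- `toStalk η y = stalkMap η (germ_{Spec T, π η} y)`
  have hfac : (((X.presheaf.germ ⊤ η trivial).hom.comp
      (π.appTop.hom.comp (Scheme.ΓSpecIso (.of T)).inv.hom)) : T →+* X.presheaf.stalk η) y =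
      (π.stalkMap η).hom (((Spec (.of T)).presheaf.germ ⊤ (π η) trivial).hom
        ((Scheme.ΓSpecIso (.of T)).inv.hom y)) := by
    rw [Scheme.Hom.germ_stalkMap_apply]
    rfl
  rw [hfac]
  intro hu
  haveI : IsLocalHom (π.stalkMap η).hom := inferInstance
  have hu' := (isUnit_map_iff (π.stalkMap η).hom _).mp hu
  -- in `𝒪_{Spec T, p} = T_p` with `p = π η = 𝔪`: a unit is outside `p`
  have key : ∀ p : Spec (.of T), p = closedPoint T →
      IsUnit (((Spec (.of T)).presheaf.germ ⊤ p trivial).hom ((Scheme.ΓSpecIso (.of T)).inv.hom y)) →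
      y ∉ maximalIdeal T := by
    rintro p rfl h
    letI : Algebra T ((Spec (.of T)).presheaf.stalk (closedPoint T)) :=
      StructureSheaf.stalkAlgebra T (closedPoint T)
    haveI : IsLocalization.AtPrime ((Spec (.of T)).presheaf.stalk (closedPoint T))
        (closedPoint T).asIdeal :=
      StructureSheaf.IsLocalization.to_stalk T (closedPoint T)
    have h' : IsUnit (algebraMap T ((Spec (.of T)).presheaf.stalk (closedPoint T)) y) := h
    exact (IsLocalization.AtPrime.isUnit_to_map_iff _ (closedPoint T).asIdeal y).mp h'
  exact key _ hη hu' hy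

end ClosedFibre

/-! ## §2 Gb -/

section Gb

variable {k K : Type} [Field k] [Field K] [Algebra k K]

/-- **Gb `stubG_carriedPrincipal` (skeleton file v19 of res-L0-w44-lead-1, verbatim; the facts
binder `Sig.stub_publishedSurfaceFacts` spelled out as its registered conjunction).**  For a singular
stage `T_m`, `m ≥ m₀ + 1`, of the sandwich context, a minimal resolution `π : X ⟶ Spec T_m`, a cycle
`Z` and an ideal `I` of `T_m` carried by `Z` along the integral exceptional curves of `π`, the ideal
`I · 𝒪_{X,x}` is principal at every point `x` of the closed fibre.  Conditional exactly on the printed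
facts Lipman 1969 (1.2) and (12.1) (ii) (the other three conjuncts are idle here).
[cite: Lipman1969, Theorem (12.1) (ii) (p. 220)] -/
theorem stubG_carriedPrincipal_holds :
    (CossartJannsenSaito2020General.{0} ∧ Lipman1969_1_2.{0} ∧ Lipman1969_4_1.{0} ∧
      Lipman1969_12_1_i.{0} ∧ Lipman1969_12_1_ii.{0}) →
    ∀ p : ℕ, p.Prime → ∀ (k K : Type) [Field k] [CharP k p] [Field K] [Algebra k K]
      (O : ValuationSubring K) (A R : Subalgebra k K) (m₀ : ℕ), SandwichCtx O A R m₀ →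
      ∀ m : ℕ, m₀ + 1 ≤ m → ¬ IsRegularLocalRing ↥(tower O A m) → ∀ [IsLocalRing ↥(tower O A m)],
      ∀ (X : Scheme.{0}) [IsIntegral X] [IsLocallyNoetherian X]
        (π : X ⟶ Spec (CommRingCat.of ↥(tower O A m))),
        IsMinimalResolution π →
        ∀ (Z : X → ℕ) (I : Ideal ↥(tower O A m)),
          (∀ t : ↥(tower O A m), t ∈ I ↔
            ((t : K) = 0 ∨ ∀ η ∈ excCurvePoints π,
              (Z η : ℤ) ≤ Scheme.ord (baseToFunctionField π t) η)) →
          ∀ x : X, IsLocalHom (((X.presheaf.germ ⊤ x trivial).hom.comp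
              (π.appTop.hom.comp (Scheme.ΓSpecIso (CommRingCat.of ↥(tower O A m))).inv.hom)) :
                ↥(tower O A m) →+* X.presheaf.stalk x) →
            (Ideal.map (((X.presheaf.germ ⊤ x trivial).hom.comp
              (π.appTop.hom.comp (Scheme.ΓSpecIso (CommRingCat.of ↥(tower O A m))).inv.hom)) :
                ↥(tower O A m) →+* X.presheaf.stalk x) I).IsPrincipal := by
  intro hF p hp k K _ _ _ _ O A R m₀ ctx m hm hsing _ X _ _ π hπ Z I hI x _
  classical
  obtain ⟨-, h12, -, -, h121ii⟩ := hF
  -- the stage: a two-dimensional normal noetherian local domain, `K = Frac T`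
  obtain ⟨hnoeth, hnorm, hfrT, hloc, hdimT, -, -⟩ := stage_package O A R m₀ ctx m hm hsing
  haveI := hnoeth
  haveI := hnorm
  have hπres : IsResolution π := hπ.isResolution
  haveI : IsProper π := hπres.isProper
  have hX : Scheme.IsRegular X := hπres.isRegular
  have hrat : HasTrivialCechH1 π :=
    hasTrivialCechH1_of_isResolution_tower h12 O A R m₀ ctx m hm hsing π hπres
  -- `H⁰(X, 𝒪_X) = T`
  have hH0 : ∀ s : X.functionField, (∀ y : X, RatFn.IsRegularAt y s) →
      ∃ t : ↥(tower O A m), baseToFunctionField π t = s :=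
    fun s hs => hπres.exists_baseToFunctionField_eq_of_forall_isRegularAt π s hs
  -- injectivity of the structure map `T → K(X)`
  have hinj : Function.Injective (baseToFunctionField π) := by
    haveI := hπres.isBirational.isDominant
    letI := (baseToFunctionField π).toAlgebra
    haveI := isFractionRing_baseToFunctionField π hπres.isBirational.isIso_stalkMap_genericPoint
    exact IsFractionRing.injective ↥(tower O A m) X.functionField
  -- the finite set `F` of integral exceptional curves, all of codimension one
  have hFfin : (excCurvePoints π).Finite :=
    (excPoints_finite π).subset (hπres.excCurvePoints_subset_excPoints hdimT)
  set F : Finset X := hFfin.toFinset with hFdef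
  have hFmem : ∀ η, η ∈ F ↔ η ∈ excCurvePoints π := fun η => Set.Finite.mem_toFinset hFfin
  have hcoh : ∀ η ∈ F, coheight η = 1 := fun η hη =>
    hπres.coheight_eq_one_of_mem_excCurvePoints hdimT ((hFmem η).mp hη)
  -- orders of elements of `T` along the curves are non-negative
  have hord_nonneg : ∀ (t : ↥(tower O A m)) (η : X), 0 ≤ Scheme.ord (baseToFunctionField π t) η :=
    fun t η => (isRegularAt_baseToFunctionField π η t).ord_nonneg
  -- a nonzero element of `I`: `y ^ N`, `y ∈ 𝔪_T ∖ 0`, `N = max Z`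
  have hnf : ¬ IsField ↥(tower O A m) := fun hf => hsing (isRegularLocalRing_of_isField hf)
  obtain ⟨y, hy𝔪, hy0⟩ : ∃ y ∈ maximalIdeal ↥(tower O A m), y ≠ 0 := by
    by_contra! h
    exact hnf (isField_iff_maximalIdeal_eq.mpr (le_bot_iff.mp fun z hz => h z hz))
  have hy1 : ∀ η ∈ F, 1 ≤ Scheme.ord (baseToFunctionField π y) η := by
    intro η hη
    have hreg := isRegularAt_baseToFunctionField π η y
    have hne : baseToFunctionField π y ≠ 0 := fun h => hy0 (hinj (by rw [h, map_zero]))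
    have hnu : ¬ RatFn.IsUnitAt η (baseToFunctionField π y) := by
      rintro ⟨u, hu⟩
      rw [← toFunctionField_germ_appTop π η y] at hu
      have := RatFn.toFunctionField_injective η hu
      exact not_isUnit_germ_appTop_of_mem_maximalIdeal π ((hFmem η).mp hη).1 hy𝔪 (this ▸ u.isUnit)
    have := hreg.ord_pos hnu hne (hcoh η hη)
    omega
  set N : ℕ := F.sup Z with hN
  have hyN : y ^ N ∈ I := by
    refine (hI _).mpr (Or.inr fun η hη => ?_)
    have hηF : η ∈ F := (hFmem η).mpr hη
    rw [map_pow, RatFn.ord_pow (fun h => hy0 (hinj (by rw [h, map_zero]))) η N]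
    calc (Z η : ℤ) ≤ N := by exact_mod_cast Finset.le_sup (f := Z) hηF
      _ = N * 1 := (mul_one _).symm
      _ ≤ N * Scheme.ord (baseToFunctionField π y) η :=
          mul_le_mul_of_nonneg_left (hy1 η hηF) (Nat.cast_nonneg N)
  have hyN0 : y ^ N ≠ 0 := pow_ne_zero N hy0
  -- the gcd cycle `Z'` of `I` on `F`
  let V : X → Set ℕ := fun η =>
    {n | ∃ t ∈ I, t ≠ 0 ∧ (Scheme.ord (baseToFunctionField π t) η).toNat = n}
  have hVne : ∀ η, (V η).Nonempty := fun η => ⟨_, y ^ N, hyN, hyN0, rfl⟩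
  let Z' : X → ℕ := fun η => sInf (V η)
  have hZ'le : ∀ t ∈ I, t ≠ 0 → ∀ η, (Z' η : ℤ) ≤ Scheme.ord (baseToFunctionField π t) η := by
    intro t ht ht0 η
    have h1 : Z' η ≤ (Scheme.ord (baseToFunctionField π t) η).toNat := Nat.sInf_le ⟨t, ht, ht0, rfl⟩
    have h2 := Int.toNat_of_nonneg (hord_nonneg t η)
    omega
  have hZ'att : ∀ η, ∃ t ∈ I, t ≠ 0 ∧ Scheme.ord (baseToFunctionField π t) η = Z' η := by
    intro η
    obtain ⟨t, ht, ht0, hteq⟩ := Nat.sInf_mem (hVne η)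
    refine ⟨t, ht, ht0, ?_⟩
    have h2 := Int.toNat_of_nonneg (hord_nonneg t η)
    change (Scheme.ord (baseToFunctionField π t) η).toNat = Z' η at hteq
    omega
  have hZZ' : ∀ η ∈ F, Z η ≤ Z' η := by
    intro η hη
    obtain ⟨t, ht, ht0, hteq⟩ := hZ'att η
    rcases (hI t).mp ht with h0 | h
    · exact absurd (Subtype.ext h0 : t = 0) ht0
    · have := h η ((hFmem η).mp hη)
      rw [hteq] at this
      exact_mod_cast this
  -- `I` is carried by `Z'` (on `F`)
  have hI' : ∀ t : ↥(tower O A m), t ∈ I ↔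
      (t = 0 ∨ ∀ η ∈ F, (Z' η : ℤ) ≤ Scheme.ord (baseToFunctionField π t) η) := by
    intro t
    constructor
    · intro ht
      by_cases ht0 : t = 0
      · exact Or.inl ht0
      · exact Or.inr fun η _ => hZ'le t ht ht0 η
    · rintro (rfl | h)
      · exact Submodule.zero_mem I
      · refine (hI t).mpr (Or.inr fun η hη => ?_)
        have hηF : η ∈ F := (hFmem η).mpr hη
        exact (Int.ofNat_le.mpr (hZZ' η hηF)).trans (h η hηF)
  -- the divisor `D = -D_{Z'}` and its section characterisation
  set D := -(CartierDivisor.ofIsEffectiveCartier (∏ η ∈ F, primeDivisorIdeal η ^ Z' η)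
    (isEffectiveCartier_cycleIdeal hX F Z' hcoh)) with hDdef
  have hDsec : ∀ s : X.functionField, D.IsSection s ↔ ((∀ x : X, RatFn.IsRegularAt x s) ∧
      (s = 0 ∨ ∀ η ∈ F, (Z' η : ℤ) ≤ Scheme.ord s η)) :=
    neg_cycleDivisor_isSection_iff hX F Z' hcoh
  -- non-negative degrees on the integral exceptional curves (gcd trick)
  have hDdeg : ∀ η ∈ excCurvePoints π, 0 ≤ excCurveDegree π D η := by
    intro η hη
    have hηF : η ∈ F := (hFmem η).mpr hη
    obtain ⟨t, ht, ht0, hteq⟩ := hZ'att η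
    set s := baseToFunctionField π t with hsdef
    have hs0 : s ≠ 0 := fun h => ht0 (hinj (by rw [← hsdef, h, map_zero]))
    have hsec : D.IsSection s := (hDsec s).mpr
      ⟨fun y => isRegularAt_baseToFunctionField π y t, Or.inr fun η' _ => hZ'le t ht ht0 η'⟩
    have heff : (D + CartierDivisor.principal s hs0).IsEffective :=
      (isEffective_neg_add_principal_iff _ hs0).mpr hsec
    have hav : (D + CartierDivisor.principal s hs0).Avoids η :=
      (CartierDivisor.avoids_add_principal_iff _ hs0).mpr
        (mem_nonvanishing_neg_cycleDivisor_of_ord_eq hX F Z' hcoh hs0 hsec hηF hteq)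
    have h := excCurveDegree_nonneg_of_isEffective π hη heff hav
    rwa [excCurveDegree_add π hη, excCurveDegree_principal π hη hs0, add_zero] at h
  -- assembly
  exact carriedPrincipal_of_divisor_of_pred h121ii hdimT.le π hπres hrat
    (fun s => ∀ η ∈ F, (Z' η : ℤ) ≤ Scheme.ord s η) I hI' D hDsec hDdeg hH0 x

/-- **Gb with the two facts it uses as separate binders** (for callers holding the v20 six-conjunction
or any other packaging of the published facts): Lipman (1.2) and (12.1) (ii), the binders of
`Sig.stubG_carriedPrincipal`, a cycle `Z` and an ideal `I` carried by `Z` ⇒ `I · 𝒪_{X,x}` principal at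
every point `x` (the closed-fibre hypothesis is not needed). Same proof as
`stubG_carriedPrincipal_holds`. [cite: Lipman1969, Theorem (12.1) (ii) (p. 220)] -/
theorem carriedPrincipal_tower_of_carried (h12 : Lipman1969_1_2.{0}) (h121ii : Lipman1969_12_1_ii.{0})
    (O : ValuationSubring K) (A R : Subalgebra k K) (m₀ : ℕ) (ctx : SandwichCtx O A R m₀) (m : ℕ)
    (hm : m₀ + 1 ≤ m) (hsing : ¬ IsRegularLocalRing ↥(tower O A m)) [IsLocalRing ↥(tower O A m)]
    {X : Scheme.{0}} [IsIntegral X] [IsLocallyNoetherian X]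
    (π : X ⟶ Spec (CommRingCat.of ↥(tower O A m))) (hπ : IsMinimalResolution π)
    (Z : X → ℕ) (I : Ideal ↥(tower O A m))
    (hI : ∀ t : ↥(tower O A m), t ∈ I ↔
      ((t : K) = 0 ∨ ∀ η ∈ excCurvePoints π, (Z η : ℤ) ≤ Scheme.ord (baseToFunctionField π t) η))
    (x : X) :
    (Ideal.map (((X.presheaf.germ ⊤ x trivial).hom.comp
      (π.appTop.hom.comp (Scheme.ΓSpecIso (CommRingCat.of ↥(tower O A m))).inv.hom)) :
        ↥(tower O A m) →+* X.presheaf.stalk x) I).IsPrincipal := by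
  classical
  -- the stage: a two-dimensional normal noetherian local domain, `K = Frac T`
  obtain ⟨hnoeth, hnorm, hfrT, hloc, hdimT, -, -⟩ := stage_package O A R m₀ ctx m hm hsing
  haveI := hnoeth
  haveI := hnorm
  have hπres : IsResolution π := hπ.isResolution
  haveI : IsProper π := hπres.isProper
  have hX : Scheme.IsRegular X := hπres.isRegular
  have hrat : HasTrivialCechH1 π :=
    hasTrivialCechH1_of_isResolution_tower h12 O A R m₀ ctx m hm hsing π hπres
  -- `H⁰(X, 𝒪_X) = T`
  have hH0 : ∀ s : X.functionField, (∀ y : X, RatFn.IsRegularAt y s) →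
      ∃ t : ↥(tower O A m), baseToFunctionField π t = s :=
    fun s hs => hπres.exists_baseToFunctionField_eq_of_forall_isRegularAt π s hs
  -- injectivity of the structure map `T → K(X)`
  have hinj : Function.Injective (baseToFunctionField π) := by
    haveI := hπres.isBirational.isDominant
    letI := (baseToFunctionField π).toAlgebra
    haveI := isFractionRing_baseToFunctionField π hπres.isBirational.isIso_stalkMap_genericPoint
    exact IsFractionRing.injective ↥(tower O A m) X.functionField
  -- the finite set `F` of integral exceptional curves, all of codimension one
  have hFfin : (excCurvePoints π).Finite :=
    (excPoints_finite π).subset (hπres.excCurvePoints_subset_excPoints hdimT)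
  set F : Finset X := hFfin.toFinset with hFdef
  have hFmem : ∀ η, η ∈ F ↔ η ∈ excCurvePoints π := fun η => Set.Finite.mem_toFinset hFfin
  have hcoh : ∀ η ∈ F, coheight η = 1 := fun η hη =>
    hπres.coheight_eq_one_of_mem_excCurvePoints hdimT ((hFmem η).mp hη)
  -- orders of elements of `T` along the curves are non-negative
  have hord_nonneg : ∀ (t : ↥(tower O A m)) (η : X), 0 ≤ Scheme.ord (baseToFunctionField π t) η :=
    fun t η => (isRegularAt_baseToFunctionField π η t).ord_nonneg
  -- a nonzero element of `I`: `y ^ N`, `y ∈ 𝔪_T ∖ 0`, `N = max Z`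
  have hnf : ¬ IsField ↥(tower O A m) := fun hf => hsing (isRegularLocalRing_of_isField hf)
  obtain ⟨y, hy𝔪, hy0⟩ : ∃ y ∈ maximalIdeal ↥(tower O A m), y ≠ 0 := by
    by_contra! h
    exact hnf (isField_iff_maximalIdeal_eq.mpr (le_bot_iff.mp fun z hz => h z hz))
  have hy1 : ∀ η ∈ F, 1 ≤ Scheme.ord (baseToFunctionField π y) η := by
    intro η hη
    have hreg := isRegularAt_baseToFunctionField π η y
    have hne : baseToFunctionField π y ≠ 0 := fun h => hy0 (hinj (by rw [h, map_zero]))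
    have hnu : ¬ RatFn.IsUnitAt η (baseToFunctionField π y) := by
      rintro ⟨u, hu⟩
      rw [← toFunctionField_germ_appTop π η y] at hu
      have := RatFn.toFunctionField_injective η hu
      exact not_isUnit_germ_appTop_of_mem_maximalIdeal π ((hFmem η).mp hη).1 hy𝔪 (this ▸ u.isUnit)
    have := hreg.ord_pos hnu hne (hcoh η hη)
    omega
  set N : ℕ := F.sup Z with hN
  have hyN : y ^ N ∈ I := by
    refine (hI _).mpr (Or.inr fun η hη => ?_)
    have hηF : η ∈ F := (hFmem η).mpr hη
    rw [map_pow, RatFn.ord_pow (fun h => hy0 (hinj (by rw [h, map_zero]))) η N]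
    calc (Z η : ℤ) ≤ N := by exact_mod_cast Finset.le_sup (f := Z) hηF
      _ = N * 1 := (mul_one _).symm
      _ ≤ N * Scheme.ord (baseToFunctionField π y) η :=
          mul_le_mul_of_nonneg_left (hy1 η hηF) (Nat.cast_nonneg N)
  have hyN0 : y ^ N ≠ 0 := pow_ne_zero N hy0
  -- the gcd cycle `Z'` of `I` on `F`
  let V : X → Set ℕ := fun η =>
    {n | ∃ t ∈ I, t ≠ 0 ∧ (Scheme.ord (baseToFunctionField π t) η).toNat = n}
  have hVne : ∀ η, (V η).Nonempty := fun η => ⟨_, y ^ N, hyN, hyN0, rfl⟩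
  let Z' : X → ℕ := fun η => sInf (V η)
  have hZ'le : ∀ t ∈ I, t ≠ 0 → ∀ η, (Z' η : ℤ) ≤ Scheme.ord (baseToFunctionField π t) η := by
    intro t ht ht0 η
    have h1 : Z' η ≤ (Scheme.ord (baseToFunctionField π t) η).toNat := Nat.sInf_le ⟨t, ht, ht0, rfl⟩
    have h2 := Int.toNat_of_nonneg (hord_nonneg t η)
    omega
  have hZ'att : ∀ η, ∃ t ∈ I, t ≠ 0 ∧ Scheme.ord (baseToFunctionField π t) η = Z' η := by
    intro η
    obtain ⟨t, ht, ht0, hteq⟩ := Nat.sInf_mem (hVne η)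
    refine ⟨t, ht, ht0, ?_⟩
    have h2 := Int.toNat_of_nonneg (hord_nonneg t η)
    change (Scheme.ord (baseToFunctionField π t) η).toNat = Z' η at hteq
    omega
  have hZZ' : ∀ η ∈ F, Z η ≤ Z' η := by
    intro η hη
    obtain ⟨t, ht, ht0, hteq⟩ := hZ'att η
    rcases (hI t).mp ht with h0 | h
    · exact absurd (Subtype.ext h0 : t = 0) ht0
    · have := h η ((hFmem η).mp hη)
      rw [hteq] at this
      exact_mod_cast this
  -- `I` is carried by `Z'` (on `F`)
  have hI' : ∀ t : ↥(tower O A m), t ∈ I ↔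
      (t = 0 ∨ ∀ η ∈ F, (Z' η : ℤ) ≤ Scheme.ord (baseToFunctionField π t) η) := by
    intro t
    constructor
    · intro ht
      by_cases ht0 : t = 0
      · exact Or.inl ht0
      · exact Or.inr fun η _ => hZ'le t ht ht0 η
    · rintro (rfl | h)
      · exact Submodule.zero_mem I
      · refine (hI t).mpr (Or.inr fun η hη => ?_)
        have hηF : η ∈ F := (hFmem η).mpr hη
        exact (Int.ofNat_le.mpr (hZZ' η hηF)).trans (h η hηF)
  -- the divisor `D = -D_{Z'}` and its section characterisation
  set D := -(CartierDivisor.ofIsEffectiveCartier (∏ η ∈ F, primeDivisorIdeal η ^ Z' η)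
    (isEffectiveCartier_cycleIdeal hX F Z' hcoh)) with hDdef
  have hDsec : ∀ s : X.functionField, D.IsSection s ↔ ((∀ x : X, RatFn.IsRegularAt x s) ∧
      (s = 0 ∨ ∀ η ∈ F, (Z' η : ℤ) ≤ Scheme.ord s η)) :=
    neg_cycleDivisor_isSection_iff hX F Z' hcoh
  -- non-negative degrees on the integral exceptional curves (gcd trick)
  have hDdeg : ∀ η ∈ excCurvePoints π, 0 ≤ excCurveDegree π D η := by
    intro η hη
    have hηF : η ∈ F := (hFmem η).mpr hη
    obtain ⟨t, ht, ht0, hteq⟩ := hZ'att η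
    set s := baseToFunctionField π t with hsdef
    have hs0 : s ≠ 0 := fun h => ht0 (hinj (by rw [← hsdef, h, map_zero]))
    have hsec : D.IsSection s := (hDsec s).mpr
      ⟨fun y => isRegularAt_baseToFunctionField π y t, Or.inr fun η' _ => hZ'le t ht ht0 η'⟩
    have heff : (D + CartierDivisor.principal s hs0).IsEffective :=
      (isEffective_neg_add_principal_iff _ hs0).mpr hsec
    have hav : (D + CartierDivisor.principal s hs0).Avoids η :=
      (CartierDivisor.avoids_add_principal_iff _ hs0).mpr
        (mem_nonvanishing_neg_cycleDivisor_of_ord_eq hX F Z' hcoh hs0 hsec hηF hteq)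
    have h := excCurveDegree_nonneg_of_isEffective π hη heff hav
    rwa [excCurveDegree_add π hη, excCurveDegree_principal π hη hs0, add_zero] at h
  -- assembly
  exact carriedPrincipal_of_divisor_of_pred h121ii hdimT.le π hπres hrat
    (fun s => ∀ η ∈ F, (Z' η : ℤ) ≤ Scheme.ord s η) I hI' D hDsec hDdeg hH0 x

end Gb

end Summit.ResolutionOfSingularities.ResolutionOfSingularities.Theorems.NoZeno.SandwichCluster

end
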